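import Summits.ResolutionOfSingularities.ResolutionOfSingularities.Theorems.FrobeniusLadderFInjectiveMacaulayficationDominatingLocFixLocalSupported
import Literature.AlgebraicGeometry.Resolution.BlowupAlgebraFlatBaseChange
import Mathlib.RingTheory.Localization.BaseChange
import Mathlib.RingTheory.Localization.LocalizationLocalization
import HarnessLib

/-!
# Blow-up charts commute with LOCALISATION of the base; regularity at every prime and the support clause descend to localisations
# (crux `FInjectiveMacaulayfication` stmt-ResolutionOfSingularities-15315, chain w45a; res-L1-w45a-plan-1 R16.54 (2)/R16.56 — ring-level half of the
# per-point transfer «semi-local scheme ⟶ stalk at `ζᵢ`» inside `clusterGrowth_multi`; seat res-L1-w45a-stub-1 g7)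

[OURS · L1 W4.5a] Support file (`--supports stmt-ResolutionOfSingularities-15315 --as helper`); NOT a statement of any manuscript; def-free, fact-free;
AI-written (AI review is weaker than expert review).

SETTING. `A → B` a localisation at a submonoid `N` (`[IsLocalization N B]`), `I ⊆ A` an ideal, `g : Fin n → A` generators / an element `a`.
* §1 `isRegularLocalRing_atPrime_of_isLocalization`: if `A_𝔔` is regular for every prime `𝔔` of `A`, then `B_{𝔔′}` is regular for every prime `𝔔′`
  of `B` (`B_{𝔔′} = A_{𝔔′ ∩ A}`, Mathlib `isLocalization_isLocalization_atPrime_isLocalization`).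
* §2 `isLocalization_blowupAlgebra`: for `J = I·B`, the chart `B[J/a]` of `Bl_J Spec B` is the localisation of the chart `A[I/a]` of `Bl_I Spec A` at
  (the image of) `N` — the affine blow-up algebra square is a pushout (`BlowupAlgebraFlatBaseChange.exists_baseChange_linearEquiv`, Stacks 0805)
  and pushouts of localisations are localisations (Mathlib `Algebra.isLocalization_iff_isPushout`).
* §3 `forall_isRegularLocalRing_chart_of_isRegular_affineBlowup`: if the affine blowing up `Bl_{(g)} Spec A` is a regular scheme, every prime of
  every chart `A[(g)/g_j]` has a regular local ring (chart ↪ `Proj`, as in `DominatingLocFixLocal`); with §1–§2: so does every prime of every chart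
  `B[(φ∘g)/φ(g_j)]` of the LOCALISED centre (`forall_isRegularLocalRing_chart_localization`).
* §4 `support_clause_localization`: the ring-level support clause «every prime `P ⊇ 𝔮` has `A_P` non-regular or `I A_P` non-principal» passes from
  `A` to `B` (for `𝔮B`, `IB`); and `support_clause_of_support_subset`: it follows on `A` from `supp 𝔮~ ⊆ Sing(Spec A) ∪ NonPrinc(I~)`
  (verbatim the bookkeeping of `DominatingLocFixLocalSupported`).
[folklore; cite: StacksProject, Tag 0805; Tag 0804; Tag 02C5] [cite: GortzWedhorn2020, Prop. 13.91 (2)] [cite: Matsumura1987, Thm. 4.3; Thm. 19.3]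
-/

-- single-problem summit: the doubled namespace component is forced
set_option linter.dupNamespace false

noncomputable section

namespace Summit.ResolutionOfSingularities.ResolutionOfSingularities.Theorems.FInjectiveMacaulayfication.BlowupChartLocalization

open CategoryTheory CategoryTheory.Limits AlgebraicGeometry TopologicalSpace IsLocalRing
open Literature.AlgebraicGeometry.Resolution
open Summit.ResolutionOfSingularities.ResolutionOfSingularities.Theorems.FInjectiveMacaulayfication


/-! ## §1 Regularity at every prime descends to localisations -/

/-- **`B_{𝔔′} ≅ A_{𝔔′ ∩ A}` for a localisation `A → B`**, as rings. [cite: Matsumura1987, Thm. 4.3] -/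
theorem nonempty_ringEquiv_atPrime_comap {A B : Type} [CommRing A] [CommRing B] [Algebra A B] (N : Submonoid A) [IsLocalization N B]
    (𝔔' : PrimeSpectrum B) :
    Nonempty (Localization.AtPrime (𝔔'.asIdeal.comap (algebraMap A B)) ≃+* Localization.AtPrime 𝔔'.asIdeal) := by
  haveI : IsLocalization.AtPrime (Localization.AtPrime 𝔔'.asIdeal) (𝔔'.asIdeal.comap (algebraMap A B)) :=
    IsLocalization.isLocalization_isLocalization_atPrime_isLocalization (M := N) (p := 𝔔'.asIdeal)
      (T := Localization.AtPrime 𝔔'.asIdeal)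
  exact ⟨(IsLocalization.algEquiv (𝔔'.asIdeal.comap (algebraMap A B)).primeCompl
    (Localization.AtPrime (𝔔'.asIdeal.comap (algebraMap A B))) (Localization.AtPrime 𝔔'.asIdeal)).toRingEquiv⟩

/-- **Regularity at every prime descends to localisations.** [cite: Matsumura1987, Thm. 19.3] -/
theorem isRegularLocalRing_atPrime_of_isLocalization {A B : Type} [CommRing A] [CommRing B] [Algebra A B] (N : Submonoid A)
    [IsLocalization N B] (hreg : ∀ 𝔔 : PrimeSpectrum A, IsRegularLocalRing (Localization.AtPrime 𝔔.asIdeal)) (𝔔' : PrimeSpectrum B) :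
    IsRegularLocalRing (Localization.AtPrime 𝔔'.asIdeal) := by
  obtain ⟨e⟩ := nonempty_ringEquiv_atPrime_comap N 𝔔'
  haveI := hreg ⟨𝔔'.asIdeal.comap (algebraMap A B), Ideal.comap_isPrime _ _⟩
  exact IsRegularLocalRing.of_ringEquiv e

/-! ## §2 The chart of the localised centre is a localisation of the chart -/

/-- **Blow-up charts commute with localisation of the base** (Stacks 0805 for `A → N⁻¹A`): for `J = I·B`, `B[J/a]` is the localisation of `A[I/a]`
at the image of `N`, along `blowupAlgebraMap`. [cite: StacksProject, Tag 0805] [cite: GortzWedhorn2020, Prop. 13.91 (2)] -/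
theorem isLocalization_blowupAlgebra {A B : Type} [CommRing A] [CommRing B] [Algebra A B] (N : Submonoid A) [IsLocalization N B]
    (I : Ideal A) (J : Ideal B) (a : A) (hIJ : I.map (algebraMap A B) ≤ J) (hJI : J ≤ I.map (algebraMap A B)) :
    @IsLocalization _ _ (N.map (algebraMap A (blowupAlgebra I a))) (blowupAlgebra J (algebraMap A B a)) _
      (blowupAlgebraMap (algebraMap A B) I J a hIJ).toAlgebra := by
  letI := (blowupAlgebraMap (algebraMap A B) I J a hIJ).toAlgebra
  haveI : IsScalarTower A (blowupAlgebra I a) (blowupAlgebra J (algebraMap A B a)) :=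
    IsScalarTower.of_algebraMap_eq fun x => by
      rw [RingHom.algebraMap_toAlgebra, blowupAlgebraMap_algebraMap, ← IsScalarTower.algebraMap_apply]
  haveI : Module.Flat A B := IsLocalization.flat B N
  -- the square `A → B`, `A[I/a] → B[J/a]` is a pushout (`B[J/a] = B ⊗_A A[I/a]`)
  haveI : Algebra.IsPushout A B (blowupAlgebra I a) (blowupAlgebra J (algebraMap A B a)) := by
    obtain ⟨e, he⟩ := BlowupAlgebraFlatBaseChange.exists_baseChange_linearEquiv I J a hIJ hJI
    refine ⟨IsBaseChange.of_equiv e fun r => ?_⟩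
    rw [he, one_smul]
    rfl
  have h := (Algebra.isLocalization_iff_isPushout N B (T := blowupAlgebra I a) (B := blowupAlgebra J (algebraMap A B a))).mpr
    (Algebra.IsPushout.symm inferInstance)
  exact h

/-! ## §3 Charts of a regular affine blowing up are regular at every prime; the localised charts too -/

set_option maxHeartbeats 800000 in
-- instance unification on the Rees chart ring `chartRing g j` is slow (as in `DominatingLocFixLocal`)
/-- **If `Bl_{(g)} Spec A` is a regular scheme, every prime of every chart `A[(g)/g_j]` has a regular local ring**: a prime `𝔔` of the chart is a
point of `Spec (A[(g)t])_{(g_j t)} ⊆ Proj A[(g)t]` (`reesChartEquiv`, `affineBlowup.chartι`) whose local ring is `A[(g)/g_j]_𝔔`.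
[cite: StacksProject, Tag 0804] -/
theorem isRegularLocalRing_chart_of_isRegular_affineBlowup {A : Type} [CommRing A] {n : ℕ} (g : Fin n → A)
    (hreg : Scheme.IsRegular (affineBlowup (Ideal.span (Set.range g)))) (j : Fin n)
    (𝔔 : PrimeSpectrum (blowupAlgebra (Ideal.span (Set.range g)) (g j))) :
    IsRegularLocalRing (Localization.AtPrime 𝔔.asIdeal) := by
  classical
  have hgj : ∀ j, g j ∈ Ideal.span (Set.range g) := fun j => Ideal.mem_span_range_self (f := g) (x := j)
  set ε : chartRing g j ≃+* blowupAlgebra (Ideal.span (Set.range g)) (g j) :=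
    reesChartEquiv (I := Ideal.span (Set.range g)) (g j) (hgj j) with hεdef
  let w : Spec (.of (chartRing g j)) :=
    ⟨𝔔.asIdeal.comap (ε : chartRing g j →+* _), Ideal.comap_isPrime (ε : chartRing g j →+* _) 𝔔.asIdeal⟩
  have hmemw : ∀ b : chartRing g j, ε b ∈ 𝔔.asIdeal ↔ b ∈ w.asIdeal := fun b => Iff.rfl
  haveI : IsIso ((affineBlowup.chartι (I := Ideal.span (Set.range g)) (g j) (hgj j)).stalkMap w) := inferInstance
  haveI := w.2
  haveI := 𝔔.2
  obtain ⟨e3⟩ := BlowupFiModelOfCover.nonempty_ringEquiv_localization_of_ringEquiv ε w.asIdeal 𝔔.asIdeal hmemw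
  have e : (affineBlowup (Ideal.span (Set.range g))).presheaf.stalk
      ((affineBlowup.chartι (I := Ideal.span (Set.range g)) (g j) (hgj j)) w) ≃+* Localization.AtPrime 𝔔.asIdeal :=
    ((asIso ((affineBlowup.chartι (I := Ideal.span (Set.range g)) (g j) (hgj j)).stalkMap w)).commRingCatIsoToRingEquiv.trans
      (Spec.stalkIso (.of (chartRing g j)) w).commRingCatIsoToRingEquiv).trans e3
  have hregx : IsRegularLocalRing ((affineBlowup (Ideal.span (Set.range g))).presheaf.stalk
      ((affineBlowup.chartι (I := Ideal.span (Set.range g)) (g j) (hgj j)) w)) := hreg _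
  haveI := hregx
  exact IsRegularLocalRing.of_ringEquiv e

/-- `(φ ∘ g)` generates `I·B` for `I = (g)`. [plumbing] -/
theorem span_range_comp_eq_map {A B : Type} [CommRing A] [CommRing B] (φ : A →+* B) {n : ℕ} (g : Fin n → A) :
    Ideal.span (Set.range (φ ∘ g)) = (Ideal.span (Set.range g)).map φ := by
  rw [Ideal.map_span, Set.range_comp]

/-- **The charts of the LOCALISED centre are regular at every prime**: if every prime of every chart `A[(g)/g_j]` has a regular local ring and
`A → B` is a localisation, then so does every prime of every chart `B[(φ∘g)/φ(g_j)]`, `φ = algebraMap A B` (§2 + §1).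
[cite: StacksProject, Tag 0805] [cite: Matsumura1987, Thm. 19.3] -/
theorem forall_isRegularLocalRing_chart_localization {A B : Type} [CommRing A] [CommRing B] [Algebra A B] (N : Submonoid A)
    [IsLocalization N B] {n : ℕ} (g : Fin n → A)
    (hreg : ∀ (j : Fin n) (𝔔 : PrimeSpectrum (blowupAlgebra (Ideal.span (Set.range g)) (g j))),
      IsRegularLocalRing (Localization.AtPrime 𝔔.asIdeal))
    (j : Fin n) (𝔔' : PrimeSpectrum (blowupAlgebra (Ideal.span (Set.range (algebraMap A B ∘ g))) (algebraMap A B (g j)))) :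
    IsRegularLocalRing (Localization.AtPrime 𝔔'.asIdeal) := by
  have hIJ : (Ideal.span (Set.range g)).map (algebraMap A B) ≤ Ideal.span (Set.range (algebraMap A B ∘ g)) :=
    (span_range_comp_eq_map (algebraMap A B) g).symm.le
  have hJI : Ideal.span (Set.range (algebraMap A B ∘ g)) ≤ (Ideal.span (Set.range g)).map (algebraMap A B) :=
    (span_range_comp_eq_map (algebraMap A B) g).le
  letI := (blowupAlgebraMap (algebraMap A B) (Ideal.span (Set.range g)) (Ideal.span (Set.range (algebraMap A B ∘ g))) (g j) hIJ).toAlgebra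
  haveI := isLocalization_blowupAlgebra N (Ideal.span (Set.range g)) (Ideal.span (Set.range (algebraMap A B ∘ g))) (g j) hIJ hJI
  exact isRegularLocalRing_atPrime_of_isLocalization (N.map (algebraMap A (blowupAlgebra (Ideal.span (Set.range g)) (g j))))
    (hreg j) 𝔔'

/-! ## §4 The support clause descends to localisations; and its derivation from `supp 𝔮~ ⊆ Sing ∪ NonPrinc(I~)` -/

/-- **The ring-level support clause passes to localisations**: if every prime `P ⊇ 𝔮` of `A` has `A_P` non-regular or `I A_P` non-principal,
then every prime `P′ ⊇ 𝔮B` of a localisation `B` of `A` has `B_{P′}` non-regular or `(IB) B_{P′}` non-principal (`B_{P′} = A_{P′ ∩ A}`).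
[cite: Matsumura1987, Thm. 4.3] -/
theorem support_clause_localization {A B : Type} [CommRing A] [CommRing B] [Algebra A B] (N : Submonoid A) [IsLocalization N B]
    (𝔮 I : Ideal A)
    (hV : ∀ P : PrimeSpectrum A, 𝔮 ≤ P.asIdeal →
      ¬ IsRegularLocalRing (Localization.AtPrime P.asIdeal) ∨ ¬ (I.map (algebraMap A (Localization.AtPrime P.asIdeal))).IsPrincipal)
    (P' : PrimeSpectrum B) (hP' : 𝔮.map (algebraMap A B) ≤ P'.asIdeal) :
    ¬ IsRegularLocalRing (Localization.AtPrime P'.asIdeal) ∨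
      ¬ ((I.map (algebraMap A B)).map (algebraMap B (Localization.AtPrime P'.asIdeal))).IsPrincipal := by
  let P : PrimeSpectrum A := ⟨P'.asIdeal.comap (algebraMap A B), Ideal.comap_isPrime _ _⟩
  have h𝔮P : 𝔮 ≤ P.asIdeal := Ideal.map_le_iff_le_comap.mp hP'
  haveI : IsLocalization.AtPrime (Localization.AtPrime P'.asIdeal) P.asIdeal :=
    IsLocalization.isLocalization_isLocalization_atPrime_isLocalization (M := N) (p := P'.asIdeal)
      (T := Localization.AtPrime P'.asIdeal)
  let e : Localization.AtPrime P.asIdeal ≃ₐ[A] Localization.AtPrime P'.asIdeal :=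
    IsLocalization.algEquiv P.asIdeal.primeCompl (Localization.AtPrime P.asIdeal) (Localization.AtPrime P'.asIdeal)
  have hcomp : e.toRingEquiv.toRingHom.comp (algebraMap A (Localization.AtPrime P.asIdeal)) =
      algebraMap A (Localization.AtPrime P'.asIdeal) := RingHom.ext fun x => e.commutes x
  have hinv : e.symm.toRingEquiv.toRingHom.comp e.toRingEquiv.toRingHom = RingHom.id _ :=
    RingHom.ext fun x => e.symm_apply_apply x
  rcases hV P h𝔮P with h | h
  · refine Or.inl fun hreg => h ?_
    haveI := hreg
    exact IsRegularLocalRing.of_ringEquiv e.symm.toRingEquiv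
  · refine Or.inr fun hpr => h ?_
    have h1 : (I.map (algebraMap A B)).map (algebraMap B (Localization.AtPrime P'.asIdeal)) =
        (I.map (algebraMap A (Localization.AtPrime P.asIdeal))).map e.toRingEquiv.toRingHom := by
      rw [Ideal.map_map, Ideal.map_map, ← IsScalarTower.algebraMap_eq, hcomp]
    have h2 : I.map (algebraMap A (Localization.AtPrime P.asIdeal)) =
        (((I.map (algebraMap A B)).map (algebraMap B (Localization.AtPrime P'.asIdeal)))).map e.symm.toRingEquiv.toRingHom := by
      rw [h1, Ideal.map_map, hinv, Ideal.map_id]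
    rw [h2]
    exact DominatingLocFixLocalSupported.isPrincipal_map _ hpr

set_option maxHeartbeats 400000 in
-- the support bookkeeping on `Spec A` elaborates large terms
/-- **The ring-level support clause from `supp 𝔮~ ⊆ Sing(Spec A) ∪ NonPrinc(I~)`**: every prime `P ⊇ 𝔮` of `A` has `A_P` non-regular or `I A_P`
non-principal (the local ring of `Spec A` at `P` is `A_P`, `Spec.stalkIso`; the stalk of `I~` there is `I A_P`,
`DominatingLocFixLocalSupported.map_stalkIso_stalkIdeal_idealSheaf`). [cite: Hartshorne1977, Ch. II Prop. 5.1 (b)] -/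
theorem support_clause_of_support_subset {A : Type} [CommRing A] (𝔮 I : Ideal A)
    (hsupp : ((affineBlowup.idealSheaf 𝔮).support : Set (Spec (.of A))) ⊆
      (Scheme.regularLocus (Spec (.of A)))ᶜ ∪ {s | ¬ (stalkIdeal (affineBlowup.idealSheaf I) s).IsPrincipal})
    (P : PrimeSpectrum A) (hP : 𝔮 ≤ P.asIdeal) :
    ¬ IsRegularLocalRing (Localization.AtPrime P.asIdeal) ∨ ¬ (I.map (algebraMap A (Localization.AtPrime P.asIdeal))).IsPrincipal := by
  classical
  let eΓ := Scheme.ΓSpecIso (.of A)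
  let s : Spec (.of A) := P
  have hs : s ∈ ((affineBlowup.idealSheaf 𝔮).support : Set (Spec (.of A))) := by
    rw [affineBlowup.idealSheaf, Scheme.IdealSheafData.coe_support_ofIdealTop, Spec_zeroLocus, ← Ideal.coe_comap,
      Ideal.comap_map_of_bijective _ (ConcreteCategory.bijective_of_isIso (C := CommRingCat) eΓ.inv)]
    change ((𝔮 : Ideal A) : Set A) ⊆ (P.asIdeal : Set A)
    exact hP
  rcases hsupp hs with h | h
  · refine Or.inl fun hreg' => h ?_
    rw [Scheme.mem_regularLocus]
    haveI := hreg'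
    exact IsRegularLocalRing.of_ringEquiv (Spec.stalkIso (.of A) s).commRingCatIsoToRingEquiv.symm
  · refine Or.inr fun hpr => h ?_
    have hback : stalkIdeal (affineBlowup.idealSheaf I) s =
        ((stalkIdeal (affineBlowup.idealSheaf I) s).map (Spec.stalkIso (CommRingCat.of A) s).hom.hom).map
          (Spec.stalkIso (CommRingCat.of A) s).inv.hom := by
      rw [Ideal.map_map, ← CommRingCat.hom_comp, Iso.hom_inv_id, CommRingCat.hom_id, Ideal.map_id]
    have h5 := DominatingLocFixLocalSupported.map_stalkIso_stalkIdeal_idealSheaf I s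
    rw [hback, h5]
    exact DominatingLocFixLocalSupported.isPrincipal_map _ hpr

end Summit.ResolutionOfSingularities.ResolutionOfSingularities.Theorems.FInjectiveMacaulayfication.BlowupChartLocalization

end
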